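import Literature.AnabelianGeometry.EtaleTheta.SettingModelKrullSemidirect
import Literature.AnabelianGeometry.EtaleTheta.SettingModelChiGroupLevelHolds
import HarnessLib

/-!
# The UNTWISTED KRULL model of the [EtTh] §1 root, file K3a: `Π^tp_X = Γ ⋊_{θ∘1} G_{ℚ_p}` is tempered, slim and
# second countable — the group-level datum `GroupLevelData (curveκ p)` is inhabited with NO binder

Mochizuki, *Semi-graphs of anabelioids*, Publ. RIMS **42** (2006) [SemiAnbd], Example 3.10 p. 43 («`π₁^temp(X_K)` …
tempered … temp-slim») [cite: MochizukiSemiAnbd2006, Ex 3.10 p.43]; [EtTh] §1 p. 12. Cell abc-iut, layer L2, seat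
abc-iut-L2-t10 (gen 5), row «coverDataAx FULLY INSTANTIATED», file K3a over K1b (`SettingModelKrullSemidirect`): the
three group-level clauses of abc-iut-L3's `TemperedCurve.GroupLevelData` at the carrier `PiTpκ p`, each BY NAME from
the χ-model toolkit with `χ ↦ 1` — tempered (abc-iut-w5-d111's `isTempered_gfp_twist_semidirect_of_isLocallyConstant`
at the CONSTANT character), slim (abc-iut-w5-d249's `Semidirect.isSlimGroup_of` with abc-iut-L2-t11's
`isSlimGroup_gfp` and abc-iut-L4's slimness of `G_{ℚ_p}`), second countable (Krasner + `secondCountableTopology_gfp`)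
— and the inhabitant `nonempty_groupLevelData_curveκ`. PROOF-ONLY; semi-synthetic model (consistency evidence only);
nothing of [SemiAnbd]/[EtTh] asserted; no side taken on [IUTchIII] Cor. 3.12; typed ≠ proved.
-/

noncomputable section

namespace Literature.AnabelianGeometry.EtaleTheta.SettingModel

open Literature.AnabelianGeometry.SemiGraphs _root_.Topology _root_.Function
open Literature.AlgebraicGeometry.Frobenioids (IsSlimGroup)

variable (p : ℕ) [Fact p.Prime]

/-- **`Π^tp_X = Γ ⋊_{θ∘1} G_{ℚ_p}` is TEMPERED** (the constant character has locally constant levels).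
[cite: MochizukiSemiAnbd2006, Ex 3.10 p.43] -/
theorem isTempered_PiTpκ : IsTempered (PiTpκ p) := by
  haveI : IsGalois ℚ_[p] (AlgebraicClosure ℚ_[p]) := {}
  haveI : CompactSpace (GQp p) := compactSpace_GQp p
  haveI : T2Space (GQp p) := krullTopology_t2
  haveI : TotallyDisconnectedSpace (GQp p) := totallyDisconnectedSpace_GQp p
  exact isTempered_gfp_twist_semidirect_of_isLocallyConstant (1 : GQp p →* MulAut ZH)
    (fun N => by
      have h : (fun σ : GQp p => ZHatLevel.levelChar N ((1 : GQp p →* MulAut ZH) σ)) = fun _ => 1 := by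
        funext σ; rw [MonoidHom.one_apply, map_one]
      rw [h]; exact IsLocallyConstant.const 1)
    (fun _ _ => rfl) (isInducing_leftRightκ p)

/-- Read on the record `curveκ p`. [cite: MochizukiSemiAnbd2006, Ex 3.10 p.43] -/
theorem isTempered_piTemp_curveκ : IsTempered (curveκ p).PiTemp := isTempered_PiTpκ p

/-- `Δ^tp_X` is tempered (closed subgroup of a tempered group). [cite: MochizukiSemiAnbd2006, Ex 3.10 p.43] -/
theorem isTempered_deltaTemp_curveκ : IsTempered (curveκ p).DeltaTemp :=
  TemperedCurve.isTempered_deltaTemp_of_isTempered (curveκ p) (isTempered_piTemp_curveκ p)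

/-- **`Π^tp_X` is SLIM** (`Γ` slim: `isSlimGroup_gfp`; `G_{ℚ_p}` slim: [pGC] Lem. 15.8 in the tree).
[cite: MochizukiSemiAnbd2006, Ex 3.10 p.43] -/
theorem isSlimGroup_PiTpκ : IsSlimGroup (PiTpκ p) :=
  Semidirect.isSlimGroup_of (isInducing_leftRightκ p) isSlimGroup_gfp
    (Literature.AnabelianGeometry.AbsoluteAnabelian.IsSubpadicFor.isSlimGroup_absoluteGaloisGroup
      (Literature.AnabelianGeometry.AbsoluteAnabelian.AbsTopIII.IsSubpadicFor.padic p))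

/-- **`Δ^tp_X` is slim** (`Δ^tp_X = inl(Γ) ≃ₜ* Γ`). [cite: MochizukiSemiAnbd2006, Ex 3.10 p.43] -/
theorem isSlimGroup_deltaTempκ : IsSlimGroup (curveκ p).DeltaTemp := by
  let e : Gfp ≃ₜ* (curveκ p).DeltaTemp :=
    { toFun := fun γ => ⟨SemidirectProduct.inl γ, inl_mem_deltaTempκ p γ⟩
      invFun := fun g => g.1.left
      left_inv := fun γ => rfl
      right_inv := fun g => by
        apply Subtype.ext
        change SemidirectProduct.inl g.1.left = g.1
        have hg : g.1.right = 1 := (mem_deltaTempκ_iff p g.1).mp g.2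
        rw [← SemidirectProduct.inl_left_mul_inr_right g.1, hg, map_one, mul_one]
        rfl
      map_mul' := fun a b => Subtype.ext (map_mul _ a b)
      continuous_toFun := (continuous_inlκ p).subtype_mk _
      continuous_invFun :=
        (Semidirect.continuous_left (isInducing_leftRightκ p)).comp continuous_subtype_val }
  exact IsSlimGroup.of_continuousMulEquiv' e isSlimGroup_gfp

/-- **`Π^tp_X` is SECOND COUNTABLE** (`Γ` and the Krull `G_{ℚ_p}` are). [cite: MochizukiSemiAnbd2006, Ex 3.10 p.43] -/
theorem secondCountableTopology_PiTpκ : SecondCountableTopology (PiTpκ p) := by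
  haveI : SecondCountableTopology Gfp := secondCountableTopology_gfp
  haveI : SecondCountableTopology (GQp p) := Literature.NumberTheory.LocalFields.secondCountableTopology_galQp p
  haveI : SecondCountableTopology (Gfp × GQp p) := inferInstance
  exact (isInducing_leftRightκ p).secondCountableTopology

/-- **The group-level datum is inhabited at `curveκ` with NO binder.** [cite: MochizukiSemiAnbd2006, Ex 3.10 p.43] -/
theorem nonempty_groupLevelData_curveκ : Nonempty (TemperedCurve.GroupLevelData (curveκ p)) := by
  have hker : ((curveκ p).augK (curveκ p).galoisIdentification).toMonoidHom.ker = (curveκ p).DeltaTemp :=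
    (curveκ p).ker_augK _
  exact ⟨{ galEquiv := (curveκ p).galoisIdentification
           isTempered := isTempered_piTemp_curveκ p
           isTempered_ker := by rw [hker]; exact isTempered_deltaTemp_curveκ p
           isSlimGroup := isSlimGroup_PiTpκ p
           isSlimGroup_ker := by rw [hker]; exact isSlimGroup_deltaTempκ p
           secondCountableTopology := secondCountableTopology_PiTpκ p }⟩

end Literature.AnabelianGeometry.EtaleTheta.SettingModel

end
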